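import Literature.Probability.RandomPlanarGeometry.SAWTriangularStripCuts
import Literature.Probability.RandomPlanarGeometry.HexSAWBrickWallStripMargin
import HarnessLib

/-!
# From an abstract slab insertion to the margin: the summation step of «TRI-STRIP-STRICT»

Topic `Literature/Probability/RandomPlanarGeometry` (continues `SAWTriangularStripCuts.lean` — the admissible cuts
`TriStrip.triCuts a υ n` of a walk of the triangular strip `S_T`, `n/(T+1) ≤ #triCuts + 3` — and uses the lattice-free
extraction `SAW.MarginExtraction.log_margin_of_core` of `HexSAWBrickWallStripMargin.lean`).  Source of the statement
shape: N. Madras, G. Slade, *The Self-Avoiding Walk* (1993), §8.2, Theorem 8.2.1, eq. (8.2.13), p. 269 (strict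
monotonicity of `μ` in the width of a tube of `ℤ^d`, printed without margin and proved by bridge renewal, p. 270); the
triangular-strip analogue with margin is the lane's (door «TRI-STRIP-STRICT»; this file is the TriStrip twin of
`HexSAWBrickWallStripInsertionCore.lean`, proofs transported verbatim with the constants of `𝕋`).

## What is proved (namespace `Literature.Probability.RandomPlanarGeometry.SAW.TriStrip`)

Let an INSERTION for the width `T` be given abstractly: for every length `n`, a map `Ψ n` from pairs `(p, R)` —
`p = (a, υ) ∈ stripPairs T n`, `R ⊆ triCuts a υ n` — to pairs, and a cost `cost n p c ∈ ℕ` per cut, with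
(i) `Ψ n p R ∈ stripPairs (T+1) (n + Σ_{c ∈ R} cost n p c)`, (ii) `cost n p c ≤ 4T + 6`, (iii) injectivity on that
domain.  THEN (`TriStrip.core_of_insertion`) the summed finite core
`c_n(S_T) xⁿ (1 + x^{4T+6})^{⌊n/(T+1)⌋} ≤ 8 Σ_{m ≤ (4T+7)n} c_m(S_{T+1}) x^m` (`0 < x ≤ 1`; the `8 = 2³` absorbs the
`− 3` of the cut density), hence (`TriStrip.log_stripConnectiveConstant_succ_sub_log_ge_of_insertion`) the margin
`log(1 + μ(S_{T+1})^{-(4T+6)})/(T+1) ≤ log μ(S_{T+1}) − log μ(S_T)` and (`TriStrip.stripConnectiveConstant_lt_succ_of_insertion`)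
`μ(S_T) < μ(S_{T+1})`.  The insertion itself is `SAWTriangularStripInsertion.lean`.

## Label (lane «pcv-sawmu», lit-2 gen 15 cell of 2026-08-23)

The strict inequality `μ(S_T(𝕋)) < μ(S_{T+1}(𝕋))` served by this file is NEW-IN-WRITING for the triangular lattice, of
a classical type, by a NEW proof route (injective slab insertion, not the printed renewal / transfer-matrix arguments):
strict monotonicity of strip connective constants is printed for `ℤ^d` [cite: MadrasSlade1993, Theorem 8.2.1 (8.2.13), p. 269 and proof p. 270 (ℤ^d tubes; statement shape — the triangular-strip analogue is not printed there)]
(Hammersley–Whittington 1985, Notes §8.5 p. 278; for `ℤ²` strips also Alm–Janson 1990 via Guttmann–Jensen LNP 775 p. 236)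
and for the honeycomb lattice [cite: BeatonBousquetMelouDeGierDuminilCopinGuttmann2014, Proposition 7 (arXiv v5 p. 11: honeycomb strips, y > 0)];
for triangular strips we located no printed statement («𝕋-strip strict inequality: not located in print (lit-2 g15,
2026-08-23; Alm–Janson 1990 not held, acq-10417)»); the lane's proof is a direct injection rather than the printed
renewal argument.
-/

noncomputable section

open Finset Filter Topology Literature.Probability.LatticeModels Literature.Probability.Percolation

namespace Literature.Probability.RandomPlanarGeometry.SAW.TriStrip

open MarginExtraction

section Core

variable {T : ℕ} (Ψ : ℕ → (Site 2 × (ℕ → Site 2)) → Finset ℤ → (Site 2 × (ℕ → Site 2)))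
  (cost : ℕ → (Site 2 × (ℕ → Site 2)) → ℤ → ℕ)

/-- The domain of an insertion at length `n`: pairs (walk of `S_T`, subset of its admissible cuts).
[cite: MadrasSlade1993, §8.2, Theorem 8.2.1 (8.2.13), p. 269 (statement; slab insertion = the lane's proof)] -/
def insDom (T n : ℕ) : Finset (Σ _ : Site 2 × (ℕ → Site 2), Finset ℤ) :=
  (stripPairs T n).sigma fun p => (triCuts p.1 p.2 n).powerset

/-- The length of the image of a pair: `n` plus the total cost of the chosen cuts.
[cite: MadrasSlade1993, §8.2, Theorem 8.2.1 (8.2.13), p. 269] -/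
def insLen (n : ℕ) (q : Σ _ : Site 2 × (ℕ → Site 2), Finset ℤ) : ℕ := n + ∑ c ∈ q.2, cost n q.1 c

/-- Membership in `insDom`. [cite: MadrasSlade1993, §8.2, Theorem 8.2.1 (8.2.13), p. 269] -/
theorem mem_insDom {n : ℕ} {q : Σ _ : Site 2 × (ℕ → Site 2), Finset ℤ} :
    q ∈ insDom T n ↔ q.1 ∈ stripPairs T n ∧ q.2 ⊆ triCuts q.1.1 q.1.2 n := by
  rw [insDom, Finset.mem_sigma, Finset.mem_powerset]

variable {Ψ cost}

/-- The image length is at most `(4T+7) n` when each cut costs at most `4T+6` (there are at most `n` cuts).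
[cite: MadrasSlade1993, §8.2, Theorem 8.2.1 (8.2.13), p. 269] -/
theorem insLen_le {n : ℕ}
    (hcost : ∀ p, p ∈ stripPairs T n → ∀ c ∈ triCuts p.1 p.2 n, cost n p c ≤ 4 * T + 6)
    {q : Σ _ : Site 2 × (ℕ → Site 2), Finset ℤ} (hq : q ∈ insDom T n) :
    insLen cost n q ≤ (4 * T + 7) * n := by
  obtain ⟨hp, hR⟩ := mem_insDom.1 hq
  have h1 : ∑ c ∈ q.2, cost n q.1 c ≤ ∑ _c ∈ q.2, (4 * T + 6) :=
    Finset.sum_le_sum fun c hc => hcost q.1 hp c (hR hc)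
  rw [Finset.sum_const, smul_eq_mul] at h1
  have hp' : (q.1.1, q.1.2) ∈ stripPairs T n := hp
  have h2 : q.2.card ≤ n := (Finset.card_le_card hR).trans (card_triCuts_le hp')
  unfold insLen
  nlinarith

/-- The generating polynomial of the pairs, regrouped by image length. [cite: MadrasSlade1993, §8.2, Theorem 8.2.1 (8.2.13), p. 269] -/
theorem sum_insDom_eq {n : ℕ}
    (hcost : ∀ p, p ∈ stripPairs T n → ∀ c ∈ triCuts p.1 p.2 n, cost n p c ≤ 4 * T + 6) (x : ℝ) :
    ∑ q ∈ insDom T n, x ^ insLen cost n q =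
      ∑ m ∈ Finset.range ((4 * T + 7) * n + 1),
        (((insDom T n).filter fun q => insLen cost n q = m).card : ℝ) * x ^ m := by
  rw [← Finset.sum_fiberwise_of_maps_to (g := insLen cost n) (t := Finset.range ((4 * T + 7) * n + 1))
    fun q hq => Finset.mem_range.2 (Nat.lt_succ_of_le (insLen_le hcost hq))]
  refine Finset.sum_congr rfl fun m _ => ?_
  rw [Finset.sum_congr rfl fun q hq => by rw [(Finset.mem_filter.1 hq).2], Finset.sum_const, nsmul_eq_mul]

/-- **Upper bound**: the pairs of image length `m` inject into the `m`-step walks of `S_{T+1}`.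
[cite: MadrasSlade1993, §8.2, Theorem 8.2.1 (8.2.13), p. 269] -/
theorem sum_insDom_le {n : ℕ}
    (hcost : ∀ p, p ∈ stripPairs T n → ∀ c ∈ triCuts p.1 p.2 n, cost n p c ≤ 4 * T + 6)
    (hmem : ∀ p R, p ∈ stripPairs T n → R ⊆ triCuts p.1 p.2 n →
      Ψ n p R ∈ stripPairs (T + 1) (n + ∑ c ∈ R, cost n p c))
    (hinj : Set.InjOn (fun q : (Σ _ : Site 2 × (ℕ → Site 2), Finset ℤ) => Ψ n q.1 q.2) ↑(insDom T n))
    {x : ℝ} (hx : 0 ≤ x) :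
    ∑ q ∈ insDom T n, x ^ insLen cost n q ≤
      ∑ m ∈ Finset.range ((4 * T + 7) * n + 1), (stripCount (T + 1) m : ℝ) * x ^ m := by
  rw [sum_insDom_eq hcost]
  refine Finset.sum_le_sum fun m _ => mul_le_mul_of_nonneg_right ?_ (pow_nonneg hx m)
  rw [stripCount]
  exact_mod_cast Finset.card_le_card_of_injOn (fun q : (Σ _ : Site 2 × (ℕ → Site 2), Finset ℤ) => Ψ n q.1 q.2)
    (fun q hq => by
      have hq' := Finset.mem_filter.1 (Finset.mem_coe.1 hq)
      obtain ⟨hp, hR⟩ := mem_insDom.1 hq'.1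
      have h := hmem q.1 q.2 hp hR
      have e : n + ∑ c ∈ q.2, cost n q.1 c = m := hq'.2
      rw [e] at h
      exact Finset.mem_coe.2 h)
    (hinj.mono fun q hq => by
      exact Finset.mem_coe.2 (Finset.mem_filter.1 (Finset.mem_coe.1 hq)).1)

/-- **Lower bound**: `Σ_{R ⊆ adm} x^{len} = xⁿ Π_{c ∈ adm} (1 + x^{cost c}) ≥ xⁿ (1 + x^{4T+6})^{#adm}` and
`(1 + x^{4T+6})^{⌊n/(T+1)⌋} ≤ 8 (1 + x^{4T+6})^{#adm}` for each walk of `S_T` (`x ≤ 1`, `⌊n/(T+1)⌋ ≤ #adm + 3`), summed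
over the walks. [cite: MadrasSlade1993, §8.2, Theorem 8.2.1 (8.2.13), p. 269] -/
theorem le_sum_insDom {n : ℕ}
    (hcost : ∀ p, p ∈ stripPairs T n → ∀ c ∈ triCuts p.1 p.2 n, cost n p c ≤ 4 * T + 6)
    {x : ℝ} (hx : 0 ≤ x) (hx1 : x ≤ 1) :
    (stripCount T n : ℝ) * x ^ n * (1 + x ^ (4 * T + 6)) ^ (n / (T + 1)) ≤
      8 * ∑ q ∈ insDom T n, x ^ insLen cost n q := by
  rw [insDom, Finset.sum_sigma, Finset.mul_sum]
  have hy0 : 0 ≤ x ^ (4 * T + 6) := pow_nonneg hx _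
  have hy1 : x ^ (4 * T + 6) ≤ 1 := pow_le_one₀ hx hx1
  have key : ∀ p ∈ stripPairs T n,
      x ^ n * (1 + x ^ (4 * T + 6)) ^ (n / (T + 1)) ≤
        8 * ∑ R ∈ (triCuts p.1 p.2 n).powerset, x ^ insLen cost n ⟨p, R⟩ := by
    intro p hp
    have hp' : (p.1, p.2) ∈ stripPairs T n := hp
    show _ ≤ 8 * ∑ R ∈ (triCuts p.1 p.2 n).powerset, x ^ (n + ∑ c ∈ R, cost n p c)
    rw [Finset.sum_congr rfl fun R _ => by rw [pow_add, ← Finset.prod_pow_eq_pow_sum],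
      ← Finset.mul_sum, ← Finset.prod_one_add, ← mul_assoc, mul_comm (8 : ℝ), mul_assoc]
    refine mul_le_mul_of_nonneg_left ?_ (pow_nonneg hx n)
    have h3 : (1 + x ^ (4 * T + 6)) ^ 3 ≤ 8 := by
      have h := pow_le_pow_left₀ (by linarith) (show 1 + x ^ (4 * T + 6) ≤ 2 by linarith) 3
      norm_num at h; exact h
    calc (1 + x ^ (4 * T + 6)) ^ (n / (T + 1))
        ≤ (1 + x ^ (4 * T + 6)) ^ ((triCuts p.1 p.2 n).card + 3) :=
          pow_le_pow_right₀ (by linarith) (div_le_card_triCuts_add hp')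
      _ = (1 + x ^ (4 * T + 6)) ^ 3 * (1 + x ^ (4 * T + 6)) ^ (triCuts p.1 p.2 n).card := by ring
      _ ≤ 8 * (1 + x ^ (4 * T + 6)) ^ (triCuts p.1 p.2 n).card :=
          mul_le_mul_of_nonneg_right h3 (pow_nonneg (by linarith) _)
      _ = 8 * ∏ _c ∈ triCuts p.1 p.2 n, (1 + x ^ (4 * T + 6)) := by rw [Finset.prod_const]
      _ ≤ 8 * ∏ c ∈ triCuts p.1 p.2 n, (1 + x ^ cost n p c) :=
          mul_le_mul_of_nonneg_left (Finset.prod_le_prod (fun c _ => by linarith) fun c hc => by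
            have := pow_le_pow_of_le_one hx hx1 (hcost p hp c hc); linarith) (by norm_num)
  calc (stripCount T n : ℝ) * x ^ n * (1 + x ^ (4 * T + 6)) ^ (n / (T + 1))
      = ∑ _p ∈ stripPairs T n, x ^ n * (1 + x ^ (4 * T + 6)) ^ (n / (T + 1)) := by
        rw [stripCount, Finset.sum_const, nsmul_eq_mul, mul_assoc]
    _ ≤ _ := Finset.sum_le_sum key

/-- **The summed finite core from an abstract insertion** on triangular strips: if for every `n` the insertion
`Ψ n` maps the pairs (walk of `S_T`, subset of its admissible cuts) injectively to walks of `S_{T+1}` of length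
`n + total cost`, each cut costing at most `4T+6`, then
`c_n(S_T) xⁿ (1 + x^{4T+6})^{⌊n/(T+1)⌋} ≤ 8 Σ_{m ≤ (4T+7)n} c_m(S_{T+1}) x^m` for all `n` and `0 < x ≤ 1`.
[cite: MadrasSlade1993, §8.2, Theorem 8.2.1 (8.2.13), p. 269 (statement; the lane's slab insertion, summed)] -/
theorem core_of_insertion
    (hcost : ∀ n p, p ∈ stripPairs T n → ∀ c ∈ triCuts p.1 p.2 n, cost n p c ≤ 4 * T + 6)
    (hmem : ∀ n p R, p ∈ stripPairs T n → R ⊆ triCuts p.1 p.2 n →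
      Ψ n p R ∈ stripPairs (T + 1) (n + ∑ c ∈ R, cost n p c))
    (hinj : ∀ n, Set.InjOn (fun q : (Σ _ : Site 2 × (ℕ → Site 2), Finset ℤ) => Ψ n q.1 q.2) ↑(insDom T n)) :
    ∀ n : ℕ, ∀ x : ℝ, 0 < x → x ≤ 1 →
      (stripCount T n : ℝ) * x ^ n * (1 + x ^ (4 * T + 6)) ^ (n / (T + 1)) ≤
        8 * ∑ m ∈ Finset.range ((4 * T + 7) * n + 1), (stripCount (T + 1) m : ℝ) * x ^ m := by
  intro n x hx hx1
  exact (le_sum_insDom (hcost n) hx.le hx1).trans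
    (mul_le_mul_of_nonneg_left (sum_insDom_le (hcost n) (hmem n) (hinj n) hx.le) (by norm_num))

end Core

/-! ### From the core to the margin and to the strict inequality -/

/-- `μ(S_T)ⁿ ≤ c_n(S_T)` for every `n` ("`μ(R) = inf_{N ≥ 1} c_N(R)^{1/N}`", (8.2.3)), triangular row strips (private twin of
the honeycomb lemma of the same name; the statements coincide textually over different constants).
[cite: MadrasSlade1993, §8.2, eq. (8.2.3), p. 268] -/
private theorem pow_stripConnectiveConstant_le_stripCount (T n : ℕ) :
    stripConnectiveConstant T ^ n ≤ (stripCount T n : ℝ) := by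
  rcases Nat.eq_zero_or_pos n with rfl | hn
  · rw [pow_zero]; exact_mod_cast one_le_stripCount T 0
  have h := stripConnectiveConstant_le_rpow T hn.ne'
  have hc : (0 : ℝ) ≤ stripCount T n := Nat.cast_nonneg _
  calc stripConnectiveConstant T ^ n ≤ ((stripCount T n : ℝ) ^ (1 / (n : ℝ))) ^ n :=
        pow_le_pow_left₀ (stripConnectiveConstant_pos T).le h n
    _ = stripCount T n := by rw [one_div, Real.rpow_inv_natCast_pow hc hn.ne']

/-- **Margin from the finite core, strip-to-strip on `𝕋`**: if an insertion gives
`c_n(S_T) xⁿ (1 + x^{4T+6})^{⌊n/(T+1)⌋} ≤ B Σ_{m ≤ Kn} c_m(S_{T+1}) x^m` for all `n` and `0 < x ≤ 1`, then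
`log(1 + μ(S_{T+1})^{-(4T+6)}) / (T+1) ≤ log μ(S_{T+1}) − log μ(S_T)`.
[cite: MadrasSlade1993, §8.2, Theorem 8.2.1, eq. (8.2.13), p. 269 (quantitative form for triangular strips, conditional on the insertion core; the lane's)] -/
theorem log_stripConnectiveConstant_succ_sub_log_ge_of_core (T : ℕ) {B : ℝ} {K : ℕ} (hB : 0 ≤ B)
    (h : ∀ n : ℕ, ∀ x : ℝ, 0 < x → x ≤ 1 →
      (stripCount T n : ℝ) * x ^ n * (1 + x ^ (4 * T + 6)) ^ (n / (T + 1)) ≤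
        B * ∑ m ∈ Finset.range (K * n + 1), (stripCount (T + 1) m : ℝ) * x ^ m) :
    Real.log (1 + stripConnectiveConstant (T + 1) ^ (-(4 * (T : ℝ) + 6))) / ((T : ℝ) + 1) ≤
      Real.log (stripConnectiveConstant (T + 1)) - Real.log (stripConnectiveConstant T) := by
  have hx := log_margin_of_core (E := 4 * T + 6) (L := T) (K := K)
    (C := fun m => (stripCount (T + 1) m : ℝ)) (B := B) (stripConnectiveConstant_pos T)
    (one_le_stripConnectiveConstant (T + 1)) hB (fun m => Nat.cast_nonneg _) (tendsto_stripCount_rpow (T + 1))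
    fun n x hx0 hx1 =>
      (mul_le_mul_of_nonneg_right (mul_le_mul_of_nonneg_right
        (pow_stripConnectiveConstant_le_stripCount T n) (pow_nonneg hx0.le n))
        (pow_nonneg (by linarith [pow_nonneg hx0.le (4 * T + 6)]) _)).trans (h n x hx0 hx1)
  have e1 : ((4 * T + 6 : ℕ) : ℝ) = 4 * (T : ℝ) + 6 := by push_cast; ring
  rwa [e1] at hx

/-- From the core to the strict inequality `μ(S_T) < μ(S_{T+1})` on `𝕋`.
[cite: MadrasSlade1993, §8.2, Theorem 8.2.1, eq. (8.2.13), p. 269 (ℤ^d tubes; here triangular strips, the lane's insertion)] -/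
theorem stripConnectiveConstant_lt_succ_of_core (T : ℕ) {B : ℝ} {K : ℕ} (hB : 0 ≤ B)
    (h : ∀ n : ℕ, ∀ x : ℝ, 0 < x → x ≤ 1 →
      (stripCount T n : ℝ) * x ^ n * (1 + x ^ (4 * T + 6)) ^ (n / (T + 1)) ≤
        B * ∑ m ∈ Finset.range (K * n + 1), (stripCount (T + 1) m : ℝ) * x ^ m) :
    stripConnectiveConstant T < stripConnectiveConstant (T + 1) := by
  have hm := log_stripConnectiveConstant_succ_sub_log_ge_of_core T hB h
  have hμ := stripConnectiveConstant_pos (T + 1)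
  have hpos : 0 < Real.log (1 + stripConnectiveConstant (T + 1) ^ (-(4 * (T : ℝ) + 6))) / ((T : ℝ) + 1) :=
    div_pos (Real.log_pos (by linarith [Real.rpow_pos_of_pos hμ (-(4 * (T : ℝ) + 6))])) (by positivity)
  have : Real.log (stripConnectiveConstant T) < Real.log (stripConnectiveConstant (T + 1)) := by linarith
  exact (Real.log_lt_log_iff (stripConnectiveConstant_pos T) hμ).1 this

section FromInsertion

variable {T : ℕ} {Ψ : ℕ → (Site 2 × (ℕ → Site 2)) → Finset ℤ → (Site 2 × (ℕ → Site 2))}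
  {cost : ℕ → (Site 2 × (ℕ → Site 2)) → ℤ → ℕ}

/-- **TRI-STRIP-STRICT from an insertion, with margin**: under (i)–(iii),
`log(1 + μ(S_{T+1})^{-(4T+6)}) / (T+1) ≤ log μ(S_{T+1}) − log μ(S_T)`.
[cite: MadrasSlade1993, §8.2, Theorem 8.2.1, eq. (8.2.13), p. 269 (quantitative form for triangular strips, conditional on the insertion; the lane's)] -/
theorem log_stripConnectiveConstant_succ_sub_log_ge_of_insertion
    (hcost : ∀ n p, p ∈ stripPairs T n → ∀ c ∈ triCuts p.1 p.2 n, cost n p c ≤ 4 * T + 6)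
    (hmem : ∀ n p R, p ∈ stripPairs T n → R ⊆ triCuts p.1 p.2 n →
      Ψ n p R ∈ stripPairs (T + 1) (n + ∑ c ∈ R, cost n p c))
    (hinj : ∀ n, Set.InjOn (fun q : (Σ _ : Site 2 × (ℕ → Site 2), Finset ℤ) => Ψ n q.1 q.2) ↑(insDom T n)) :
    Real.log (1 + stripConnectiveConstant (T + 1) ^ (-(4 * (T : ℝ) + 6))) / ((T : ℝ) + 1) ≤
      Real.log (stripConnectiveConstant (T + 1)) - Real.log (stripConnectiveConstant T) :=
  log_stripConnectiveConstant_succ_sub_log_ge_of_core T (by norm_num) (core_of_insertion hcost hmem hinj)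

/-- **TRI-STRIP-STRICT from an insertion**: under (i)–(iii), `μ(S_T) < μ(S_{T+1})` for the triangular strips.
[cite: MadrasSlade1993, §8.2, Theorem 8.2.1, eq. (8.2.13), p. 269 (ℤ^d tubes; here triangular strips, the lane's insertion)] -/
theorem stripConnectiveConstant_lt_succ_of_insertion
    (hcost : ∀ n p, p ∈ stripPairs T n → ∀ c ∈ triCuts p.1 p.2 n, cost n p c ≤ 4 * T + 6)
    (hmem : ∀ n p R, p ∈ stripPairs T n → R ⊆ triCuts p.1 p.2 n →
      Ψ n p R ∈ stripPairs (T + 1) (n + ∑ c ∈ R, cost n p c))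
    (hinj : ∀ n, Set.InjOn (fun q : (Σ _ : Site 2 × (ℕ → Site 2), Finset ℤ) => Ψ n q.1 q.2) ↑(insDom T n)) :
    stripConnectiveConstant T < stripConnectiveConstant (T + 1) :=
  stripConnectiveConstant_lt_succ_of_core T (by norm_num) (core_of_insertion hcost hmem hinj)

end FromInsertion

end Literature.Probability.RandomPlanarGeometry.SAW.TriStrip
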